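import Literature.MathematicalPhysics.QuantumLattice.DWaveNodalThermalLawTorus
import Literature.MathematicalPhysics.QuantumLattice.DWaveSourceFreePressure
import Literature.MathematicalPhysics.QuantumLattice.TorusCooperSum
import HarnessLib

/-!
# The free `d`-wave-sourced torus is frozen below the gap: `0 ≤ p̃_L(β) - p̃_L(∞) ≤ C (T³ + T/L²)/|h|`

Topic `Literature/MathematicalPhysics/QuantumLattice`; applies the nodal `T²`-law on the discrete torus
(`DWaveNodalThermalLawTorus.exists_sum_exp_neg_mul_bdgEnergy_le`) to the free (`U = 0`) `d`-wave-sourced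
Hubbard torus `dWaveSourceTorus L 0 μ h` of `DWaveSource` / `DWaveSourceFreePressure`, whose partition
function is the explicit Bogoliubov–de Gennes product `partitionFn_dWaveSourceTorus_zero_re`
(`Tr e^{-βH_L(h)} = 2^{2L²} Π_k e^{-βξ_k}(1 + cosh βE_k)/2`, `ξ_k = ε_L(k) - μ`,
`E_k = √(ξ_k² + 8h² ĝ_d(k)²)`).

* `log_one_add_cosh_div_two_eq_add_log` — `log((1 + cosh x)/2) = x - 2 log 2 + 2 log(1 + e^{-x})`
  (companion of `BdGModeGainBound.log_one_add_cosh_div_two`, which gives `2 log cosh(x/2)`);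
* `log_partitionFn_dWaveSourceTorus_zero_eq_sum` — **ground-state / thermal splitting of the free
  sourced pressure**: `log Tr e^{-βH_L(h)} = Σ_k [β(E_k - ξ_k) + 2 log(1 + e^{-βE_k})]` (`L ≥ 3`);
* `log_partitionFn_dWaveSourceTorus_zero_sub_groundState_nonneg` /
  `exists_log_partitionFn_dWaveSourceTorus_zero_sub_groundState_le` — **the thermal part is
  non-negative and `O((T³ + T/L²)/|h|)`**: for `[μ₁, μ₂] ⊂ (-4, 0)` and `h₀ > 0` there is `C ≥ 0` with
  `0 ≤ β⁻¹L⁻² log Tr e^{-βH_L(h)} - L⁻² Σ_k (E_k - ξ_k) ≤ C (1/β³ + 1/(βL²))/|h|`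
  for all `μ ∈ [μ₁, μ₂]`, `0 < |h| ≤ h₀`, `β > 0`, `L ≥ 3`.

So the finite-volume free sourced pressure `p̃_L(β, μ, h) = β⁻¹L⁻² log Tr e^{-βH_L(h)}` sits within
`C(T³ + T/L²)/|h|` of its zero-temperature value `L⁻² Σ_k (E_k - ξ_k)` (the BdG condensation functional),
uniformly in `L`, in the level window and in the source `0 < |h| ≤ h₀`: in the cold regime `T ≪ |h|` of a
regulated pair source the free system is thermodynamically frozen up to the `T³` weight of the four Dirac
cones. Everything is proved; no definitions. [folklore]

## Sources

Folklore (BdG thermodynamics: J. von Delft, D. C. Ralph, Phys. Rep. 345 (2001) 61, §4.2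
(`VondelftRalph2001`); nodal `T³` free energy of `d`-wave superconductors: N. E. Hussey, Adv. Phys. 51
(2002) 1685, §2).
-/

noncomputable section

open Real Finset
open Literature.Probability.LatticeModels

namespace Literature.MathematicalPhysics.QuantumLattice

/-- `log((1 + cosh x)/2) = x - 2 log 2 + 2 log(1 + e^{-x})` (`(1 + cosh x)/2 = e^x (1 + e^{-x})²/4`).
[folklore] -/
theorem log_one_add_cosh_div_two_eq_add_log (x : ℝ) :
    Real.log ((1 + Real.cosh x) / 2) = x - 2 * Real.log 2 + 2 * Real.log (1 + Real.exp (-x)) := by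
  have he : 0 < Real.exp x := Real.exp_pos x
  have he' : 0 < 1 + Real.exp (-x) := by positivity
  have hid : (1 + Real.cosh x) / 2 = Real.exp x * (1 + Real.exp (-x)) ^ 2 / 4 := by
    rw [Real.cosh_eq, Real.exp_neg]
    field_simp
    ring
  rw [hid, Real.log_div (by positivity) (by norm_num), Real.log_mul he.ne' (by positivity),
    Real.log_exp, Real.log_pow, show (4 : ℝ) = 2 ^ 2 by norm_num, Real.log_pow]
  push_cast
  ring

/-- `0 ≤ log(1 + e^{-x}) ≤ e^{-x}`. [folklore] -/
theorem log_one_add_exp_neg_mem (x : ℝ) :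
    0 ≤ Real.log (1 + Real.exp (-x)) ∧ Real.log (1 + Real.exp (-x)) ≤ Real.exp (-x) := by
  have h0 : 0 < Real.exp (-x) := Real.exp_pos _
  refine ⟨Real.log_nonneg (by linarith), ?_⟩
  have := Real.log_le_sub_one_of_pos (show 0 < 1 + Real.exp (-x) by linarith)
  linarith

variable {L : ℕ} [NeZero L]

/-- **Ground-state / thermal splitting of the free `d`-wave-sourced torus pressure** (`L ≥ 3`):
`log Tr e^{-β H_L(h)} = Σ_k [β(E_k - ξ_k) + 2 log(1 + e^{-βE_k})]`, `ξ_k = ε_L(k) - μ`,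
`E_k = √(ξ_k² + (2√2 h ĝ_d(k))²)`. [folklore] -/
theorem log_partitionFn_dWaveSourceTorus_zero_eq_sum (hL : 3 ≤ L) (β μ s : ℝ) :
    Real.log (Matrix.partitionFn β (dWaveSourceTorus L 0 μ s)).re =
      ∑ k : TorusSite 2 L,
        (β * (Real.sqrt ((torusBand L k - μ) ^ 2 + (2 * Real.sqrt 2 * s * dWaveGap k) ^ 2) -
            (torusBand L k - μ)) +
          2 * Real.log (1 + Real.exp (-(β * Real.sqrt ((torusBand L k - μ) ^ 2 +
            (2 * Real.sqrt 2 * s * dWaveGap k) ^ 2))))) := by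
  rw [partitionFn_dWaveSourceTorus_zero_re hL]
  have hpow : (0 : ℝ) < (2 : ℝ) ^ Fintype.card (Orb (FermionTorus 2 L)) := by positivity
  have hfac : ∀ k : TorusSite 2 L, Real.exp (-(β * (torusBand L k - μ))) *
      ((1 + Real.cosh (β * Real.sqrt ((torusBand L k - μ) ^ 2 + (2 * Real.sqrt 2 * s * dWaveGap k) ^ 2))) / 2) ≠ 0 :=
    fun k => (bdgModeFactor_pos β _ _).ne'
  rw [Real.log_mul hpow.ne' (Finset.prod_ne_zero_iff.2 fun k _ => hfac k),
    Real.log_prod (s := Finset.univ) (hf := fun k _ => hfac k), Real.log_pow, card_orb_fermionTorus_two]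
  -- per-mode identity
  have hmode : ∀ k : TorusSite 2 L, Real.log (Real.exp (-(β * (torusBand L k - μ))) *
      ((1 + Real.cosh (β * Real.sqrt ((torusBand L k - μ) ^ 2 + (2 * Real.sqrt 2 * s * dWaveGap k) ^ 2))) / 2)) =
      (β * (Real.sqrt ((torusBand L k - μ) ^ 2 + (2 * Real.sqrt 2 * s * dWaveGap k) ^ 2) -
            (torusBand L k - μ)) +
          2 * Real.log (1 + Real.exp (-(β * Real.sqrt ((torusBand L k - μ) ^ 2 +
            (2 * Real.sqrt 2 * s * dWaveGap k) ^ 2))))) - 2 * Real.log 2 := by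
    intro k
    have hc : 0 < (1 + Real.cosh (β * Real.sqrt ((torusBand L k - μ) ^ 2 +
        (2 * Real.sqrt 2 * s * dWaveGap k) ^ 2))) / 2 := by
      have := Real.one_le_cosh (β * Real.sqrt ((torusBand L k - μ) ^ 2 + (2 * Real.sqrt 2 * s * dWaveGap k) ^ 2))
      positivity
    rw [Real.log_mul (Real.exp_pos _).ne' hc.ne', Real.log_exp, log_one_add_cosh_div_two_eq_add_log]
    ring
  rw [Finset.sum_congr rfl fun k _ => hmode k, Finset.sum_sub_distrib, Finset.sum_const, Finset.card_univ,
    card_torusSite_two L, nsmul_eq_mul]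
  push_cast
  ring

/-- **The thermal part of the free sourced pressure is non-negative**:
`L⁻² Σ_k (E_k - ξ_k) ≤ β⁻¹L⁻² log Tr e^{-βH_L(h)}` (`β > 0`, `L ≥ 3`). [folklore] -/
theorem log_partitionFn_dWaveSourceTorus_zero_sub_groundState_nonneg (hL : 3 ≤ L) {β : ℝ} (hβ : 0 < β)
    (μ s : ℝ) :
    0 ≤ Real.log (Matrix.partitionFn β (dWaveSourceTorus L 0 μ s)).re / (β * (L : ℝ) ^ 2) -
      (∑ k : TorusSite 2 L, (Real.sqrt ((torusBand L k - μ) ^ 2 + (2 * Real.sqrt 2 * s * dWaveGap k) ^ 2) -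
        (torusBand L k - μ))) / (L : ℝ) ^ 2 := by
  have hLpos : (0 : ℝ) < L := by exact_mod_cast (show 0 < L by omega)
  rw [log_partitionFn_dWaveSourceTorus_zero_eq_sum hL, Finset.sum_add_distrib, ← Finset.mul_sum, add_div,
    mul_div_mul_left _ _ hβ.ne', add_sub_cancel_left]
  refine div_nonneg (Finset.sum_nonneg fun k _ => ?_) (by positivity)
  exact mul_nonneg zero_le_two (log_one_add_exp_neg_mem _).1

/-- **The free `d`-wave-sourced torus is frozen below the gap.** For `[μ₁, μ₂] ⊂ (-4, 0)` and `h₀ > 0`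
there is `C ≥ 0` such that for all `μ ∈ [μ₁, μ₂]`, `0 < |h| ≤ h₀`, `β > 0` and `L ≥ 3`,
`β⁻¹L⁻² log Tr e^{-βH_L(h)} - L⁻² Σ_k (E_k - ξ_k) ≤ C (1/β³ + 1/(βL²)) / |h|`. [folklore] -/
theorem exists_log_partitionFn_dWaveSourceTorus_zero_sub_groundState_le {μ₁ μ₂ h₀ : ℝ} (hμ₁ : -4 < μ₁)
    (hμ₂ : μ₂ < 0) (hh₀ : 0 < h₀) :
    ∃ C : ℝ, 0 ≤ C ∧ ∀ μ ∈ Set.Icc μ₁ μ₂, ∀ s : ℝ, s ≠ 0 → |s| ≤ h₀ → ∀ β : ℝ, 0 < β →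
      ∀ (L : ℕ) [NeZero L], 3 ≤ L →
        Real.log (Matrix.partitionFn β (dWaveSourceTorus L 0 μ s)).re / (β * (L : ℝ) ^ 2) -
          (∑ k : TorusSite 2 L, (Real.sqrt ((torusBand L k - μ) ^ 2 + (2 * Real.sqrt 2 * s * dWaveGap k) ^ 2) -
            (torusBand L k - μ))) / (L : ℝ) ^ 2 ≤
          C * (1 / β ^ 3 + 1 / (β * (L : ℝ) ^ 2)) / |s| := by
  have hs2 : 0 < 2 * Real.sqrt 2 := by positivity
  obtain ⟨C₀, hC₀, hsum⟩ := exists_sum_exp_neg_mul_bdgEnergy_le hμ₁ hμ₂ (mul_pos hs2 hh₀)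
  refine ⟨2 * C₀ / (2 * Real.sqrt 2), by positivity, fun μ hμ s hs hsh β hβ L _ hL => ?_⟩
  have hLpos : (0 : ℝ) < L := by exact_mod_cast (show 0 < L by omega)
  have hL2 : (0 : ℝ) < (L : ℝ) ^ 2 := by positivity
  have hsa : 0 < |s| := abs_pos.2 hs
  have hΔ : 2 * Real.sqrt 2 * |s| ∈ Set.Ioc (0 : ℝ) (2 * Real.sqrt 2 * h₀) :=
    ⟨mul_pos hs2 hsa, mul_le_mul_of_nonneg_left hsh hs2.le⟩
  -- rewrite the energies with `|s|`
  have hE : ∀ k : TorusSite 2 L, (2 * Real.sqrt 2 * s * dWaveGap k) ^ 2 = (2 * Real.sqrt 2 * |s| * dWaveGap k) ^ 2 :=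
    fun k => by
      rw [show (2 * Real.sqrt 2 * |s| * dWaveGap k) ^ 2 = (2 * Real.sqrt 2) ^ 2 * |s| ^ 2 * dWaveGap k ^ 2 by ring,
        sq_abs]
      ring
  have hS := hsum μ hμ (2 * Real.sqrt 2 * |s|) hΔ β hβ L
  rw [log_partitionFn_dWaveSourceTorus_zero_eq_sum hL, Finset.sum_add_distrib, ← Finset.mul_sum, add_div,
    mul_div_mul_left _ _ hβ.ne', add_sub_cancel_left]
  -- the thermal part: `Σ 2 log(1 + e^{-βE}) ≤ 2 Σ e^{-βE} ≤ 2 C₀ (L²/β² + 1)/Δ`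
  have hth : ∑ k : TorusSite 2 L, 2 * Real.log (1 + Real.exp (-(β * Real.sqrt ((torusBand L k - μ) ^ 2 +
      (2 * Real.sqrt 2 * s * dWaveGap k) ^ 2)))) ≤ 2 * (C₀ * ((L : ℝ) ^ 2 / β ^ 2 + 1) / (2 * Real.sqrt 2 * |s|)) := by
    rw [← Finset.mul_sum]
    refine mul_le_mul_of_nonneg_left ?_ zero_le_two
    refine le_trans (Finset.sum_le_sum fun k _ => (log_one_add_exp_neg_mem _).2) ?_
    simp_rw [hE]
    exact hS
  calc (∑ k : TorusSite 2 L, 2 * Real.log (1 + Real.exp (-(β * Real.sqrt ((torusBand L k - μ) ^ 2 +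
        (2 * Real.sqrt 2 * s * dWaveGap k) ^ 2))))) / (β * (L : ℝ) ^ 2)
      ≤ 2 * (C₀ * ((L : ℝ) ^ 2 / β ^ 2 + 1) / (2 * Real.sqrt 2 * |s|)) / (β * (L : ℝ) ^ 2) :=
        div_le_div_of_nonneg_right hth (by positivity)
    _ = 2 * C₀ / (2 * Real.sqrt 2) * (1 / β ^ 3 + 1 / (β * (L : ℝ) ^ 2)) / |s| := by
        field_simp

end Literature.MathematicalPhysics.QuantumLattice

end
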